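import Summits.Parity.GeneralizedHardyLittlewood.Theorems.BeyondDiagonalBeatsQuarter.OffDiagSliceTransformDeriv
import Summits.Parity.GeneralizedHardyLittlewood.Theorems.BeyondDiagonalBeatsQuarter.OffDiagDualCostBoxSwap
import Summits.Parity.GeneralizedHardyLittlewood.Theorems.BeyondDiagonalBeatsQuarter.OffDiagDualBoxSize
import HarnessLib

/-!
# Route `PrimeLevelFamEdge`, crux K_B (stmt-Parity-20343), line `diagonal_kernel_split` rev 4, plan Ω,
# a8P closable principal piece (input (e)/I3 of `OffDiagPrincipalClosableTotal`, K_B constants) — **an explicit,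
# uniform bound for the HEIGHT derivative of the box weight, `‖∂₂Φ_i(t₁,y)‖ ≤ M_box`, hence for the derivative
# family of the sample weight: `‖𝓕(t₁ ↦ ∂₂Φ_i(t₁,y))(ξ)‖ ≤ M_box·(3K₁/2)`**

For the pairs `p = (l,m)` of the Sobolev device (`OffDiagKFamilySobolev`, worker-3) the frequency parameters
`α = l/d₁`, `β = m/d₂` are naturals, so the box weight is `OffDiag.boxWeight q d₁ d₂ α β c i` and prover-2's L2c
pointwise slice costs apply after the symmetry `boxWeight_swap` (the `t₂`-derivative of `Φ_i` is the
`t₁`-derivative of the swapped weight). This file turns them into the `B₁` slot of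
`OffDiagSliceTransformDeriv.fourier_slice_height_regularity`, with every constant explicit
(`K_j = 2^{i_j}`, `𝓒₁ = Σ_{j<2} binom(1,j)(2ʲΘ_j)((1−j+1)²(1−j)!(1−j)^{1−j}) = 4Θ₀ + 2Θ₁`, `Θ_j = dyadicBumpBound j`):

* `boxWeight_slice_eq_zero_of_not_mem`, `heightDeriv_boxWeight_eq_zero_of_not_mem` — off the `t₁`-box
  `[K₁/2, 2K₁]` the slice `y ↦ Φ_i(t₁,y)` is identically `0`, so `∂₂Φ_i(t₁,y) = 0`;
* `norm_heightDeriv_boxWeight_le_pointwise` — on the box, prover-2's `k = 1` slice cost for the swapped weight: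
  `‖∂₂Φ_i(t₁,y)‖ ≤ 𝓒₁·(1 + |4π√(βα t₁)/(qc)|·√y)·(|θ(t₁/K₁)|·(|(d₂d₁t₁)^{−1/2}c⁻¹|·y^{−1/2}))·y⁻¹`;
* **`norm_heightDeriv_boxWeight_le`** — for ALL `t₁` and `y ∈ [K₂/2, 2K₂]`:
  `‖∂₂Φ_i(t₁,y)‖ ≤ M_box := 𝓒₁·(1 + 4π√(αβ·2K₁)·√(2K₂)/(qc))·((d₁d₂(K₁/2))^{−1/2}·c⁻¹)·(K₂/2)^{−1/2}·(K₂/2)⁻¹`;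
* **`norm_fourier_heightDeriv_boxWeight_le`** — `‖𝓕(t₁ ↦ ∂₂Φ_i(t₁,y))(ξ)‖ ≤ M_box·(2K₁ − K₁/2)` for
  `y ∈ [K₂/2, 2K₂]`, all `ξ` (the `B₁` of the Sobolev device; `hg`, `hg′` are `hasDerivAt_fourier_slice`,
  `continuous_fourier_sliceDeriv` with `contDiff_uncurry_boxWeight`, `hasCompactSupport_uncurry_boxWeight`).

Absolute values only; theorems only; standard axioms. Helper toward `stub_offDiagBelowSlack_io`
(`--supports stmt-Parity-20343`); closes nothing.
«The programme SEARCHES and TYPES; no claim about Landau–Siegel zeros, Theorems 1–2 of arXiv:2211.02515 or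
a repaired Margin232 until a kernel theorem says so.»
-/

noncomputable section

open Set MeasureTheory
open scoped Real FourierTransform ContDiff Nat

namespace Summit.Parity.GeneralizedHardyLittlewood.Theorems.BeyondDiagonalBeatsQuarter.OffDiag

open Literature.NumberTheory.LFunctions Literature.NumberTheory.LFunctions.KMV2000
open Literature.Analysis.Calculus.WhitneyConvex (dyadicBump dyadicBumpBound dyadicBump_nonneg dyadicBump_le_one
  dyadicBumpBound_nonneg)
open OffDiagPoissonTwisted (norm_iteratedDeriv_boxWeight_slice_le boxWeight_slice_snd_eq)

variable {q d₁ d₂ α β c : ℕ}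

/-! ### §1. Off the `t₁`-box the height slice is identically zero -/

/-- For `t₁ ∉ [K₁/2, 2K₁]` the height slice `y ↦ Φ_i(t₁,y)` is the zero function. [folklore] -/
theorem boxWeight_slice_eq_zero_of_not_mem (i : ℕ × ℕ) {t₁ : ℝ}
    (ht : t₁ ∉ Icc ((2 : ℝ) ^ i.1 / 2) (2 * 2 ^ i.1)) :
    boxWeight q d₁ d₂ α β c i t₁ = fun _ ↦ 0 := by
  funext y
  exact boxWeight_eq_zero_of_not_mem (fun h ↦ ht h.1)

/-- … hence its height derivative vanishes there: `∂₂Φ_i(t₁,y) = 0` for `t₁ ∉ [K₁/2, 2K₁]`. [folklore] -/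
theorem heightDeriv_boxWeight_eq_zero_of_not_mem [NeZero q] (hd₁ : 1 ≤ d₁) (hd₂ : 1 ≤ d₂) (hα : 1 ≤ α)
    (hβ : 1 ≤ β) (i : ℕ × ℕ) {t₁ : ℝ} (ht : t₁ ∉ Icc ((2 : ℝ) ^ i.1 / 2) (2 * 2 ^ i.1)) (y : ℝ) :
    fderiv ℝ (Function.uncurry (boxWeight q d₁ d₂ α β c i)) (t₁, y) ((0 : ℝ), (1 : ℝ)) = 0 := by
  rw [← deriv_slice_right_eq (contDiff_uncurry_boxWeight (q := q) (r := c) hd₁ hd₂ hα hβ i),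
    boxWeight_slice_eq_zero_of_not_mem i ht, deriv_const]

/-! ### §2. On the box: prover-2's slice cost for the swapped weight -/

/-- **Pointwise height-derivative cost on the box.** For `q, d₁, d₂, α, β ≥ 1`, `t₁ > 0` and `0 < y ≤ 2·2^{i₂}`:
`‖∂₂Φ_i(t₁,y)‖ ≤ 𝓒₁·(1 + |4π√(βα·t₁)/(qc)|·√y)·(|θ(t₁/2^{i₁})|·(|(d₂d₁t₁)^{−1/2}c⁻¹|·y^{−1/2}))·(y¹)⁻¹`
(`OffDiagDualCostBoxWeight.norm_iteratedDeriv_boxWeight_slice_le`, `k = 1`, swapped data). [folklore] -/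
theorem norm_heightDeriv_boxWeight_le_pointwise [NeZero q] (hd₁ : 1 ≤ d₁) (hd₂ : 1 ≤ d₂) (hα : 1 ≤ α)
    (hβ : 1 ≤ β) (i : ℕ × ℕ) {t₁ : ℝ} (ht₁ : 0 < t₁) {y : ℝ} (hy : 0 < y) (hyK : y ≤ 2 * 2 ^ i.2) :
    ‖fderiv ℝ (Function.uncurry (boxWeight q d₁ d₂ α β c i)) (t₁, y) ((0 : ℝ), (1 : ℝ))‖ ≤
      (∑ j ∈ Finset.range (1 + 1), ((1 : ℕ).choose j : ℝ) * (2 ^ j * dyadicBumpBound j) *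
          ((((1 - j : ℕ) : ℝ) + 1) ^ 2 * (1 - j) ! * ((1 - j : ℕ) : ℝ) ^ (1 - j))) *
        (1 + |4 * π * Real.sqrt ((β : ℝ) * α * t₁) / ((q : ℝ) * c)| * Real.sqrt y) ^ 1 *
        (|dyadicBump (t₁ / 2 ^ i.1)| *
          (|((d₂ : ℝ) * d₁ * t₁) ^ (-(1 : ℝ) / 2) * (c : ℝ)⁻¹| * y ^ (-(1 : ℝ) / 2))) *
        (y ^ 1)⁻¹ := by
  rw [← deriv_slice_right_eq (contDiff_uncurry_boxWeight (q := q) (r := c) hd₁ hd₂ hα hβ i),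
    ← iteratedDeriv_one, boxWeight_slice_snd_eq i t₁]
  have h := norm_iteratedDeriv_boxWeight_slice_le (q := q) (α := β) (β := α) (r := c) hd₂ hd₁ i.swap 1 ht₁ hy
    (by simpa only [Prod.fst_swap] using hyK)
  simpa only [Prod.fst_swap, Prod.snd_swap] using h

/-- The constant `𝓒₁ = 4Θ₀ + 2Θ₁ ≥ 0`. [folklore] -/
theorem costConst_one_nonneg :
    0 ≤ ∑ j ∈ Finset.range (1 + 1), ((1 : ℕ).choose j : ℝ) * (2 ^ j * dyadicBumpBound j) *
        ((((1 - j : ℕ) : ℝ) + 1) ^ 2 * (1 - j) ! * ((1 - j : ℕ) : ℝ) ^ (1 - j)) := by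
  refine Finset.sum_nonneg fun j _ ↦ ?_
  have := dyadicBumpBound_nonneg j
  positivity

/-! ### §3. The uniform box constant `M_box` -/

/-- **Uniform height-derivative bound.** For `q, d₁, d₂, α, β ≥ 1`, `c ≥ 1`, ALL `t₁` and `y ∈ [K₂/2, 2K₂]`
(`K_j = 2^{i_j}`):
`‖∂₂Φ_i(t₁,y)‖ ≤ M_box = 𝓒₁·(1 + 4π√(βα·(2K₁))/(qc)·√(2K₂))·((d₂d₁(K₁/2))^{−1/2}·c⁻¹)·(K₂/2)^{−1/2}·(K₂/2)⁻¹`.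
[folklore] -/
theorem norm_heightDeriv_boxWeight_le [NeZero q] (hd₁ : 1 ≤ d₁) (hd₂ : 1 ≤ d₂) (hα : 1 ≤ α) (hβ : 1 ≤ β)
    (hc : 1 ≤ c) (i : ℕ × ℕ) (t₁ : ℝ) {y : ℝ} (hy : y ∈ Icc ((2 : ℝ) ^ i.2 / 2) (2 * 2 ^ i.2)) :
    ‖fderiv ℝ (Function.uncurry (boxWeight q d₁ d₂ α β c i)) (t₁, y) ((0 : ℝ), (1 : ℝ))‖ ≤
      (∑ j ∈ Finset.range (1 + 1), ((1 : ℕ).choose j : ℝ) * (2 ^ j * dyadicBumpBound j) *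
          ((((1 - j : ℕ) : ℝ) + 1) ^ 2 * (1 - j) ! * ((1 - j : ℕ) : ℝ) ^ (1 - j))) *
        (1 + 4 * π * Real.sqrt ((β : ℝ) * α * (2 * 2 ^ i.1)) / ((q : ℝ) * c) * Real.sqrt (2 * 2 ^ i.2)) *
        ((((d₂ : ℝ) * d₁ * ((2 : ℝ) ^ i.1 / 2)) ^ (-(1 : ℝ) / 2) * (c : ℝ)⁻¹) * ((2 : ℝ) ^ i.2 / 2) ^ (-(1 : ℝ) / 2)) *
        (((2 : ℝ) ^ i.2 / 2))⁻¹ := by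
  set C₁ : ℝ := ∑ j ∈ Finset.range (1 + 1), ((1 : ℕ).choose j : ℝ) * (2 ^ j * dyadicBumpBound j) *
    ((((1 - j : ℕ) : ℝ) + 1) ^ 2 * (1 - j) ! * ((1 - j : ℕ) : ℝ) ^ (1 - j)) with hC₁
  have hC₁0 : 0 ≤ C₁ := costConst_one_nonneg
  have hK₁ : (0 : ℝ) < 2 ^ i.1 := by positivity
  have hK₂ : (0 : ℝ) < 2 ^ i.2 := by positivity
  have hq0 : (0 : ℝ) < q := by exact_mod_cast Nat.pos_of_ne_zero (NeZero.ne q)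
  have hc0 : (0 : ℝ) < c := by exact_mod_cast hc
  have hd₁0 : (0 : ℝ) < d₁ := by exact_mod_cast hd₁
  have hd₂0 : (0 : ℝ) < d₂ := by exact_mod_cast hd₂
  have hα0 : (0 : ℝ) < α := by exact_mod_cast hα
  have hβ0 : (0 : ℝ) < β := by exact_mod_cast hβ
  obtain ⟨hy1, hy2⟩ := hy
  have hy0 : 0 < y := lt_of_lt_of_le (by positivity) hy1
  -- the right-hand side is non-negative
  have hRHS0 : 0 ≤ C₁ *
      (1 + 4 * π * Real.sqrt ((β : ℝ) * α * (2 * 2 ^ i.1)) / ((q : ℝ) * c) * Real.sqrt (2 * 2 ^ i.2)) *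
      ((((d₂ : ℝ) * d₁ * ((2 : ℝ) ^ i.1 / 2)) ^ (-(1 : ℝ) / 2) * (c : ℝ)⁻¹) * ((2 : ℝ) ^ i.2 / 2) ^ (-(1 : ℝ) / 2)) *
      (((2 : ℝ) ^ i.2 / 2))⁻¹ := by
    have h1 : 0 ≤ (((d₂ : ℝ) * d₁ * ((2 : ℝ) ^ i.1 / 2)) ^ (-(1 : ℝ) / 2)) := Real.rpow_nonneg (by positivity) _
    have h2 : 0 ≤ ((2 : ℝ) ^ i.2 / 2) ^ (-(1 : ℝ) / 2) := Real.rpow_nonneg (by positivity) _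
    positivity
  by_cases ht : t₁ ∈ Icc ((2 : ℝ) ^ i.1 / 2) (2 * 2 ^ i.1)
  swap
  · rw [heightDeriv_boxWeight_eq_zero_of_not_mem hd₁ hd₂ hα hβ i ht y, norm_zero]; exact hRHS0
  obtain ⟨ht1, ht2⟩ := ht
  have ht0 : 0 < t₁ := lt_of_lt_of_le (by positivity) ht1
  refine (norm_heightDeriv_boxWeight_le_pointwise hd₁ hd₂ hα hβ i ht0 hy0 hy2).trans ?_
  rw [pow_one, pow_one]
  -- factor by factor
  have f1 : 1 + |4 * π * Real.sqrt ((β : ℝ) * α * t₁) / ((q : ℝ) * c)| * Real.sqrt y ≤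
      1 + 4 * π * Real.sqrt ((β : ℝ) * α * (2 * 2 ^ i.1)) / ((q : ℝ) * c) * Real.sqrt (2 * 2 ^ i.2) := by
    rw [abs_of_nonneg (by positivity)]
    have hs1 : Real.sqrt ((β : ℝ) * α * t₁) ≤ Real.sqrt ((β : ℝ) * α * (2 * 2 ^ i.1)) :=
      Real.sqrt_le_sqrt (mul_le_mul_of_nonneg_left ht2 (by positivity))
    have hs2 : Real.sqrt y ≤ Real.sqrt (2 * 2 ^ i.2) := Real.sqrt_le_sqrt hy2
    have h4 : 4 * π * Real.sqrt ((β : ℝ) * α * t₁) / ((q : ℝ) * c) * Real.sqrt y ≤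
        4 * π * Real.sqrt ((β : ℝ) * α * (2 * 2 ^ i.1)) / ((q : ℝ) * c) * Real.sqrt (2 * 2 ^ i.2) :=
      mul_le_mul (div_le_div_of_nonneg_right (mul_le_mul_of_nonneg_left hs1 (by positivity : (0 : ℝ) ≤ 4 * π))
        (by positivity : (0 : ℝ) ≤ (q : ℝ) * c)) hs2 (Real.sqrt_nonneg _) (by positivity)
    linarith
  have f2 : |dyadicBump (t₁ / 2 ^ i.1)| ≤ 1 := by
    rw [abs_of_nonneg (dyadicBump_nonneg _)]; exact dyadicBump_le_one _
  have f3 : |((d₂ : ℝ) * d₁ * t₁) ^ (-(1 : ℝ) / 2) * (c : ℝ)⁻¹| ≤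
      ((d₂ : ℝ) * d₁ * ((2 : ℝ) ^ i.1 / 2)) ^ (-(1 : ℝ) / 2) * (c : ℝ)⁻¹ := by
    have hr0 : 0 ≤ ((d₂ : ℝ) * d₁ * t₁) ^ (-(1 : ℝ) / 2) := Real.rpow_nonneg (by positivity) _
    rw [abs_of_nonneg (mul_nonneg hr0 (by positivity))]
    refine mul_le_mul_of_nonneg_right ?_ (by positivity)
    exact Real.rpow_le_rpow_of_nonpos (by positivity) (mul_le_mul_of_nonneg_left ht1 (by positivity))
      (by norm_num)
  have f4 : y ^ (-(1 : ℝ) / 2) ≤ ((2 : ℝ) ^ i.2 / 2) ^ (-(1 : ℝ) / 2) :=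
    Real.rpow_le_rpow_of_nonpos (by positivity) hy1 (by norm_num)
  have f5 : y⁻¹ ≤ (((2 : ℝ) ^ i.2 / 2))⁻¹ := inv_anti₀ (by positivity) hy1
  have g3 : 0 ≤ |((d₂ : ℝ) * d₁ * t₁) ^ (-(1 : ℝ) / 2) * (c : ℝ)⁻¹| := abs_nonneg _
  have g4 : 0 ≤ y ^ (-(1 : ℝ) / 2) := Real.rpow_nonneg hy0.le _
  have gB : 0 ≤ ((2 : ℝ) ^ i.2 / 2) ^ (-(1 : ℝ) / 2) := Real.rpow_nonneg (by positivity) _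
  have gA : 0 ≤ ((d₂ : ℝ) * d₁ * ((2 : ℝ) ^ i.1 / 2)) ^ (-(1 : ℝ) / 2) * (c : ℝ)⁻¹ := by
    have := Real.rpow_nonneg (by positivity : (0:ℝ) ≤ (d₂ : ℝ) * d₁ * ((2 : ℝ) ^ i.1 / 2)) (-(1:ℝ)/2)
    positivity
  have inner : |dyadicBump (t₁ / 2 ^ i.1)| * (|((d₂ : ℝ) * d₁ * t₁) ^ (-(1 : ℝ) / 2) * (c : ℝ)⁻¹| * y ^ (-(1 : ℝ) / 2))
      ≤ 1 * ((((d₂ : ℝ) * d₁ * ((2 : ℝ) ^ i.1 / 2)) ^ (-(1 : ℝ) / 2) * (c : ℝ)⁻¹) *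
          ((2 : ℝ) ^ i.2 / 2) ^ (-(1 : ℝ) / 2)) :=
    mul_le_mul f2 (mul_le_mul f3 f4 g4 gA) (by positivity) zero_le_one
  rw [one_mul] at inner
  have hI0 : 0 ≤ |dyadicBump (t₁ / 2 ^ i.1)| *
      (|((d₂ : ℝ) * d₁ * t₁) ^ (-(1 : ℝ) / 2) * (c : ℝ)⁻¹| * y ^ (-(1 : ℝ) / 2)) := by positivity
  calc C₁ * (1 + |4 * π * Real.sqrt ((β : ℝ) * α * t₁) / ((q : ℝ) * c)| * Real.sqrt y) *
        (|dyadicBump (t₁ / 2 ^ i.1)| * (|((d₂ : ℝ) * d₁ * t₁) ^ (-(1 : ℝ) / 2) * (c : ℝ)⁻¹| * y ^ (-(1 : ℝ) / 2))) *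
        y⁻¹
      ≤ C₁ * (1 + 4 * π * Real.sqrt ((β : ℝ) * α * (2 * 2 ^ i.1)) / ((q : ℝ) * c) * Real.sqrt (2 * 2 ^ i.2)) *
          ((((d₂ : ℝ) * d₁ * ((2 : ℝ) ^ i.1 / 2)) ^ (-(1 : ℝ) / 2) * (c : ℝ)⁻¹) * ((2 : ℝ) ^ i.2 / 2) ^ (-(1 : ℝ) / 2)) *
          (((2 : ℝ) ^ i.2 / 2))⁻¹ := by
        refine mul_le_mul (mul_le_mul (mul_le_mul_of_nonneg_left f1 hC₁0) inner hI0 (by positivity)) f5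
          (by positivity) (by positivity)

/-! ### §4. The `B₁` slot: the derivative family of the sample weight -/

/-- **The derivative family of the sample weight is bounded**: for `q, d₁, d₂, α, β, c ≥ 1`, `y ∈ [K₂/2, 2K₂]`, all `ξ`:
`‖𝓕(t₁ ↦ ∂₂Φ_i(t₁,y))(ξ)‖ ≤ M_box·(2K₁ − K₁/2)`. With `hasDerivAt_fourier_slice` and `continuous_fourier_sliceDeriv`
(`Φ := boxWeight …`, smooth of compact support) these are the `hg`, `hg′`, `B₁` of the Sobolev device. [folklore] -/
theorem norm_fourier_heightDeriv_boxWeight_le [NeZero q] (hd₁ : 1 ≤ d₁) (hd₂ : 1 ≤ d₂) (hα : 1 ≤ α) (hβ : 1 ≤ β)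
    (hc : 1 ≤ c) (i : ℕ × ℕ) {y : ℝ} (hy : y ∈ Icc ((2 : ℝ) ^ i.2 / 2) (2 * 2 ^ i.2)) (ξ : ℝ) :
    ‖𝓕 (fun t₁ : ℝ ↦ fderiv ℝ (Function.uncurry (boxWeight q d₁ d₂ α β c i)) (t₁, y) ((0 : ℝ), (1 : ℝ))) ξ‖ ≤
      (∑ j ∈ Finset.range (1 + 1), ((1 : ℕ).choose j : ℝ) * (2 ^ j * dyadicBumpBound j) *
          ((((1 - j : ℕ) : ℝ) + 1) ^ 2 * (1 - j) ! * ((1 - j : ℕ) : ℝ) ^ (1 - j))) *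
        (1 + 4 * π * Real.sqrt ((β : ℝ) * α * (2 * 2 ^ i.1)) / ((q : ℝ) * c) * Real.sqrt (2 * 2 ^ i.2)) *
        ((((d₂ : ℝ) * d₁ * ((2 : ℝ) ^ i.1 / 2)) ^ (-(1 : ℝ) / 2) * (c : ℝ)⁻¹) * ((2 : ℝ) ^ i.2 / 2) ^ (-(1 : ℝ) / 2)) *
        (((2 : ℝ) ^ i.2 / 2))⁻¹ * (2 * 2 ^ i.1 - 2 ^ i.1 / 2) := by
  refine norm_fourier_le_of_norm_le_of_support (f := fun t₁ : ℝ ↦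
      fderiv ℝ (Function.uncurry (boxWeight q d₁ d₂ α β c i)) (t₁, y) ((0 : ℝ), (1 : ℝ)))
    (by have : (0 : ℝ) < 2 ^ i.1 := by positivity
        linarith)
    (fun t₁ ↦ norm_heightDeriv_boxWeight_le hd₁ hd₂ hα hβ hc i t₁ hy) (fun t₁ ht ↦ ?_) ξ
  exact heightDeriv_boxWeight_eq_zero_of_not_mem hd₁ hd₂ hα hβ i ht y

end Summit.Parity.GeneralizedHardyLittlewood.Theorems.BeyondDiagonalBeatsQuarter.OffDiag
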